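import Summits.Ventures.GridStability.Models.InverterLinearisation

/-!
# GridStability/Models/UniformDampingSpectrum — second-order network systems with a UNIFORM damping ratio: the `2n`-dimensional spectrum decouples into quadratics over a symmetric pencil (linear algebra for the solver-free small-signal lane)

Cell `gridfusion` (LADDER-GRIDFUSION, APEX LINE «inverter-dominated networks», rung G3 / wave-1
candidate row «G3-ss» (lead 02:39:27Z, certnum RQ-013); seat gridfusion-model-3 (g5)). Pure linear
algebra used by `Models/InverterNetworkLinearisation.lean` (the droop-microgrid / classical-model
reading); network version of the degree-2 Routh–Hurwitz rate form `quadratic_re_lt_neg_iff` of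
`Models/InverterLinearisation.lean` (p490298).

* `secondOrderJac A d = [[0, 1], [−A, −d·1]]` on `ι ⊕ ι` — the Jacobian pattern of `ẍ + d ẋ + A x = 0`;
* `secondOrderJac_eig_iff` — `J [x; y] = z [x; y]` iff `y = z x` and `A x = −(z² + d z) x`: every mode is a
  root of a QUADRATIC `z² + d z + ν = 0` over an eigenvalue `ν` of `A` (same position eigenvector);
* `secondOrderJac_eig_sync` — `A x = 0` (synchronous mode) ⇒ `z ∈ {0, −d}`;
* `secondOrderJac_re_lt_neg` — `A x = μ x` with `μ ≥ ν₀` real, `d > 2r`, `ν₀ − d r + r² > 0` ⇒ `Re z < −r`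
  [cite: HairerNorsettWanner1993, §I.13 Theorem 13.4];
* `pencil_eig_real_gt` — THE CERTIFICATE SHAPE (any `n`, no SDP): `L` real with zero column sums,
  `m > 0` weights; if `L − ν₀·diag(m) + β·(m mᵀ)` is positive definite for some `β`, every solution of
  `L x = μ·diag(m) x`, `x ≠ 0` complex, has `μ = 0` or `μ` REAL with `μ > ν₀`;

THREE COLUMNS: linear algebra only ([folklore]); no model, no parameter values, no stability sentence.
-/

noncomputable section

open Real Matrix Finset
open scoped ComplexOrder ComplexConjugate

namespace Summit.Ventures.GridStability.Models

/-! ## §0 Second-order systems with a uniform damping ratio: the linear algebra -/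

section SecondOrder

variable {ι : Type*} [Fintype ι] [DecidableEq ι] {R : Type*} [CommRing R]

/-- The Jacobian pattern of a second-order network system `ẍ + d ẋ + A x = 0` with UNIFORM damping
ratio `d`, in first-order form on `ι ⊕ ι` (positions, velocities): `J(A, d) = [[0, 1], [−A, −d·1]]`.
[folklore] -/
def secondOrderJac (A : Matrix ι ι R) (d : R) : Matrix (ι ⊕ ι) (ι ⊕ ι) R :=
  Matrix.fromBlocks 0 1 (-A) (-(d • (1 : Matrix ι ι R)))

omit [Fintype ι] in
/-- `J(A, d)` commutes with a change of scalars (used with `ℝ → ℂ`). [folklore] -/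
theorem secondOrderJac_map {S : Type*} [CommRing S] (f : R →+* S) (A : Matrix ι ι R) (d : R) :
    (secondOrderJac A d).map f = secondOrderJac (A.map f) (f d) := by
  ext (i | i) (j | j) <;> simp [secondOrderJac, Matrix.one_apply, apply_ite f]

/-- `J(A, d) [x; y] = [y; −A x − d y]`. [folklore] -/
theorem secondOrderJac_mulVec (A : Matrix ι ι R) (d : R) (w : ι ⊕ ι → R) :
    secondOrderJac A d *ᵥ w
      = Sum.elim (w ∘ Sum.inr) (-(A *ᵥ (w ∘ Sum.inl)) - d • (w ∘ Sum.inr)) := by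
  rw [secondOrderJac, Matrix.fromBlocks_mulVec]
  simp [Matrix.neg_mulVec, Matrix.smul_mulVec, sub_eq_add_neg]

/-- **Eigen-correspondence (the decoupling).** `[x; y]` is an eigenvector of `J(A, d)` for `z` iff
`y = z x` and `A x = −(z² + d z) x`: the modes of the `2n`-dimensional linearisation are exactly the
roots of the quadratics `z² + d z + ν = 0`, `ν` an eigenvalue of `A` (same position eigenvector `x`).
[folklore] -/
theorem secondOrderJac_eig_iff (A : Matrix ι ι R) (d z : R) (w : ι ⊕ ι → R) :
    secondOrderJac A d *ᵥ w = z • w ↔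
      (w ∘ Sum.inr = z • (w ∘ Sum.inl) ∧
        A *ᵥ (w ∘ Sum.inl) = -((z ^ 2 + d * z) • (w ∘ Sum.inl))) := by
  rw [secondOrderJac_mulVec]
  constructor
  · intro h
    have h1 : w ∘ Sum.inr = z • (w ∘ Sum.inl) := by
      funext i
      have := congr_fun h (Sum.inl i)
      simpa using this
    refine ⟨h1, ?_⟩
    funext i
    have h2 := congr_fun h (Sum.inr i)
    have h1i : w (Sum.inr i) = z * w (Sum.inl i) := by simpa using congr_fun h1 i
    simp only [Sum.elim_inr, Pi.sub_apply, Pi.neg_apply, Pi.smul_apply, smul_eq_mul,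
      Function.comp_apply, h1i] at h2
    simp only [Pi.neg_apply, Pi.smul_apply, smul_eq_mul, Function.comp_apply]
    linear_combination -h2
  · rintro ⟨h1, h2⟩
    funext j
    rcases j with i | i
    · have h1i : w (Sum.inr i) = z * w (Sum.inl i) := by simpa using congr_fun h1 i
      simpa using h1i
    · have h1i : w (Sum.inr i) = z * w (Sum.inl i) := by simpa using congr_fun h1 i
      have h2i := congr_fun h2 i
      simp only [Pi.neg_apply, Pi.smul_apply, smul_eq_mul, Function.comp_apply] at h2i
      simp only [Sum.elim_inr, Pi.sub_apply, Pi.neg_apply, Pi.smul_apply, smul_eq_mul,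
        Function.comp_apply, h1i, h2i]
      ring

/-- An eigenvector of `J(A, d)` has a nonzero POSITION part. [folklore] -/
theorem secondOrderJac_eig_fst_ne_zero {A : Matrix ι ι R} {d z : R} {w : ι ⊕ ι → R}
    (hJ : secondOrderJac A d *ᵥ w = z • w) (hw : w ≠ 0) : w ∘ Sum.inl ≠ 0 := by
  intro hx
  apply hw
  have h1 := ((secondOrderJac_eig_iff A d z w).1 hJ).1
  rw [hx, smul_zero] at h1
  funext j
  rcases j with i | i
  · exact congr_fun hx i
  · exact congr_fun h1 i

end SecondOrder

section Complex

variable {ι : Type*} [Fintype ι] [DecidableEq ι]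

/-- **The synchronous mode.** If the position part `x` of an eigenvector of `J(A, d)` lies in the
kernel of `A` (for the network Laplacian: the uniform angle shift), then `z = 0` or `z = −d`.
[folklore] -/
theorem secondOrderJac_eig_sync {A : Matrix ι ι ℂ} {d z : ℂ} {w : ι ⊕ ι → ℂ}
    (hJ : secondOrderJac A d *ᵥ w = z • w) (hw : w ≠ 0) (hAx : A *ᵥ (w ∘ Sum.inl) = 0) :
    z = 0 ∨ z = -d := by
  have hx := secondOrderJac_eig_fst_ne_zero hJ hw
  have h2 := ((secondOrderJac_eig_iff A d z w).1 hJ).2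
  rw [hAx, eq_comm, neg_eq_zero, smul_eq_zero] at h2
  rcases h2 with h | h
  · have : z * (z + d) = 0 := by linear_combination h
    rcases mul_eq_zero.1 this with h' | h'
    · exact Or.inl h'
    · exact Or.inr (by linear_combination h')
  · exact absurd h hx

/-- **Rate form.** If the position part `x` of an eigenvector of `J(A, d)` (`A`, `d` real data) is an
eigenvector of `A` for a REAL eigenvalue `μ ≥ ν₀`, and `d > 2r`, `ν₀ − d r + r² > 0`, then `Re z < −r`
(Routh–Hurwitz for `z² + d z + μ`, `quadratic_re_lt_neg_iff`).
[cite: HairerNorsettWanner1993, §I.13 Theorem 13.4] -/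
theorem secondOrderJac_re_lt_neg {A : Matrix ι ι ℂ} {d r ν₀ : ℝ} {z : ℂ} {w : ι ⊕ ι → ℂ}
    (hJ : secondOrderJac A (d : ℂ) *ᵥ w = z • w) (hw : w ≠ 0)
    (hμ : ∃ μ : ℝ, ν₀ ≤ μ ∧ A *ᵥ (w ∘ Sum.inl) = (μ : ℂ) • (w ∘ Sum.inl))
    (hd : 0 < d - 2 * r) (hν : 0 < ν₀ - d * r + r ^ 2) : z.re < -r := by
  obtain ⟨μ, hμν, hAx⟩ := hμ
  have hx := secondOrderJac_eig_fst_ne_zero hJ hw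
  have h2 := ((secondOrderJac_eig_iff A (d : ℂ) z w).1 hJ).2
  rw [hAx] at h2
  have h3 : ((μ : ℂ) + (z ^ 2 + (d : ℂ) * z)) • (w ∘ Sum.inl) = 0 := by
    rw [add_smul, h2, neg_add_cancel]
  rw [smul_eq_zero] at h3
  rcases h3 with h | h
  · have hq : z ^ 2 + (d : ℝ) * z + (μ : ℝ) = 0 := by linear_combination h
    exact (quadratic_re_lt_neg_iff d μ r).2 ⟨hd, by linarith⟩ z hq
  · exact absurd h hx

/-! ### The symmetric pencil `L x = ν M x` and its PSD certificate -/

omit [DecidableEq ι] in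
/-- Entry formula for a real matrix acting on a complex vector. [folklore] -/
theorem map_ofReal_mulVec_apply (S : Matrix ι ι ℝ) (x : ι → ℂ) (i : ι) :
    (S.map ((↑) : ℝ → ℂ) *ᵥ x) i = ∑ j, (S i j : ℂ) * x j := by
  simp [Matrix.mulVec, dotProduct]

/-- **The pencil certificate (any `n`, solver-free).** Let `L` be a real SYMMETRIC matrix with zero
column sums (a weighted Laplacian: `L 1 = 0`), `m` positive weights («inertias» `M_i`). If for some
`β` the real symmetric matrix `L − ν₀·diag(m) + β·(m mᵀ)` is positive definite, then every solution
of the generalised eigenproblem `L x = μ·diag(m) x` with `x ≠ 0` (complex) has `μ = 0` (the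
synchronous mode) or `μ` REAL with `μ > ν₀`. Proof: `1ᵀL = 0` gives `Σ m_i x_i = 0` when `μ ≠ 0`, so
the rank-one term vanishes on `x` and `x*(L − ν₀ M)x = (μ − ν₀)·Σ m_i|x_i|² > 0`. [folklore] -/
theorem pencil_eig_real_gt {L : Matrix ι ι ℝ} {m : ι → ℝ} (hm : ∀ i, 0 < m i)
    (hcol : ∀ j, ∑ i, L i j = 0) {ν₀ β : ℝ}
    (hS : (L - ν₀ • Matrix.diagonal m + β • Matrix.vecMulVec m m).PosDef)
    {μ : ℂ} {x : ι → ℂ} (hx : x ≠ 0)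
    (hLx : L.map ((↑) : ℝ → ℂ) *ᵥ x = μ • fun i => (m i : ℂ) * x i) :
    μ = 0 ∨ (μ.im = 0 ∧ ν₀ < μ.re) := by
  by_cases hμ0 : μ = 0
  · exact Or.inl hμ0
  right
  -- (1) the weighted sum of the eigenvector vanishes: Σ m_i x_i = 0
  have hsum : ∑ i, (m i : ℂ) * x i = 0 := by
    have h1 : ∑ i, (L.map ((↑) : ℝ → ℂ) *ᵥ x) i = 0 := by
      simp_rw [map_ofReal_mulVec_apply]
      rw [Finset.sum_comm]
      refine Finset.sum_eq_zero fun j _ => ?_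
      rw [← Finset.sum_mul]
      have : (∑ i, (L i j : ℂ)) = 0 := by exact_mod_cast hcol j
      rw [this, zero_mul]
    rw [hLx] at h1
    simp only [Pi.smul_apply, smul_eq_mul, ← Finset.mul_sum] at h1
    rcases mul_eq_zero.1 h1 with h | h
    · exact absurd h hμ0
    · exact h
  -- (2) the certificate matrix acts on x as (μ − ν₀)·M
  set S : Matrix ι ι ℝ := L - ν₀ • Matrix.diagonal m + β • Matrix.vecMulVec m m with hSdef
  have hSx : ∀ i, (S.map ((↑) : ℝ → ℂ) *ᵥ x) i = (μ - ν₀) * ((m i : ℂ) * x i) := by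
    intro i
    have hLi : ∑ j, (L i j : ℂ) * x j = μ * ((m i : ℂ) * x i) := by
      have := congr_fun hLx i
      rw [map_ofReal_mulVec_apply] at this
      simpa using this
    rw [map_ofReal_mulVec_apply]
    have hentry : ∀ j, (S i j : ℂ) * x j
        = (L i j : ℂ) * x j - (if i = j then (ν₀ : ℂ) * ((m i : ℂ) * x j) else 0)
          + (β : ℂ) * (m i : ℂ) * ((m j : ℂ) * x j) := by
      intro j
      simp only [hSdef, Matrix.add_apply, Matrix.sub_apply, Matrix.smul_apply, smul_eq_mul,
        Matrix.vecMulVec_apply]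
      by_cases hij : i = j
      · subst hij
        simp only [Matrix.diagonal_apply_eq, if_true]
        push_cast
        ring
      · simp only [Matrix.diagonal_apply_ne _ hij, if_neg hij]
        push_cast
        ring
    simp_rw [hentry]
    rw [Finset.sum_add_distrib, Finset.sum_sub_distrib, hLi, Finset.sum_ite_eq, ← Finset.mul_sum,
      hsum]
    simp only [Finset.mem_univ, if_true, mul_zero, add_zero]
    ring
  -- (3) positivity of the two quadratic forms
  -- a real positive definite matrix stays positive definite over `ℂ` ([folklore]; cf. the tree's
  -- `Literature.Geometry.Kaehler.ComplexTorus.posDef_map_ofRealHom`, not imported here)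
  have hSC : (S.map Complex.ofRealHom).PosDef := by
    have hsd : (S.map Complex.ofRealHom).PosSemidef := by
      open scoped MatrixOrder in
      obtain ⟨B, hB⟩ := CStarAlgebra.nonneg_iff_eq_star_mul_self.mp hS.posSemidef.nonneg
      rw [hB, Matrix.star_eq_conjTranspose, Matrix.map_mul,
        Matrix.conjTranspose_map _ (fun a => by simp)]
      exact Matrix.posSemidef_conjTranspose_mul_self _
    refine hsd.posDef_iff_det_ne_zero.mpr ?_
    rw [← RingHom.mapMatrix_apply, ← RingHom.map_det, Complex.ofRealHom_eq_coe,
      Complex.ofReal_ne_zero]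
    exact hS.det_pos.ne'
  have hq : 0 < star x ⬝ᵥ (S.map ((↑) : ℝ → ℂ) *ᵥ x) := hSC.dotProduct_mulVec_pos hx
  have hqeq : star x ⬝ᵥ (S.map ((↑) : ℝ → ℂ) *ᵥ x)
      = (μ - ν₀) * ∑ i, (m i : ℂ) * (starRingEnd ℂ (x i) * x i) := by
    simp only [dotProduct, Pi.star_apply, hSx, Finset.mul_sum]
    refine Finset.sum_congr rfl fun i _ => ?_
    rw [Complex.star_def]
    ring
  have hpsum : ∑ i, (m i : ℂ) * (starRingEnd ℂ (x i) * x i)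
      = ((∑ i, m i * Complex.normSq (x i) : ℝ) : ℂ) := by
    push_cast
    refine Finset.sum_congr rfl fun i _ => ?_
    rw [Complex.normSq_eq_conj_mul_self]
  have hp_pos : 0 < ∑ i, m i * Complex.normSq (x i) := by
    obtain ⟨i, hi⟩ : ∃ i, x i ≠ 0 := by
      by_contra h
      push Not at h
      exact hx (funext h)
    refine lt_of_lt_of_le (mul_pos (hm i) (Complex.normSq_pos.2 hi)) ?_
    exact Finset.single_le_sum (f := fun i => m i * Complex.normSq (x i))
      (fun j _ => mul_nonneg (hm j).le (Complex.normSq_nonneg _)) (Finset.mem_univ i)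
  rw [hqeq, hpsum] at hq
  set p : ℝ := ∑ i, m i * Complex.normSq (x i) with hpdef
  have hdiv : μ - ν₀ = (μ - ν₀) * (p : ℂ) * ((p⁻¹ : ℝ) : ℂ) := by
    have hp0 : (p : ℂ) ≠ 0 := by exact_mod_cast hp_pos.ne'
    push_cast
    field_simp
  obtain ⟨hre, him⟩ := Complex.pos_iff.1 hq
  have key_im : (μ - ν₀).im = 0 := by
    rw [hdiv, Complex.im_mul_ofReal, ← him, zero_mul]
  have key_re : 0 < (μ - ν₀).re := by
    rw [hdiv, Complex.re_mul_ofReal]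
    exact mul_pos hre (inv_pos.2 hp_pos)
  constructor
  · simpa using key_im
  · have : (μ - (ν₀ : ℂ)).re = μ.re - ν₀ := by simp
    linarith [this ▸ key_re]

omit [Fintype ι] in
/-- `J(A, d)` with real data, read over `ℂ` (where the spectrum lives). [folklore] -/
theorem secondOrderJac_map_ofReal (A : Matrix ι ι ℝ) (d : ℝ) :
    (secondOrderJac A d).map ((↑) : ℝ → ℂ) = secondOrderJac (A.map ((↑) : ℝ → ℂ)) (d : ℂ) :=
  secondOrderJac_map Complex.ofRealHom A d

/-! ### The synchronous mode: the kernel of the Laplacian is the uniform shift (same certificate) -/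

omit [DecidableEq ι] in
/-- Constant vectors lie in the kernel of a matrix with zero ROW sums. [folklore] -/
theorem mulVec_const_eq_zero_of_rowsum {L : Matrix ι ι ℝ} (hrow : ∀ i, ∑ j, L i j = 0) (c : ℂ) :
    L.map ((↑) : ℝ → ℂ) *ᵥ (fun _ => c) = 0 := by
  funext i
  rw [map_ofReal_mulVec_apply]
  simp only [Pi.zero_apply, ← Finset.sum_mul]
  have : (∑ j, (L i j : ℂ)) = 0 := by exact_mod_cast hrow i
  rw [this, zero_mul]

/-- **The synchronous mode is the uniform shift (any `n`, from the SAME certificate).** Let `L` be real with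
zero row sums, `m > 0`, `ν₀ ≥ 0`, and `L − ν₀·diag(m) + β·(m mᵀ)` positive definite for some `β`. Then every
complex `x` with `L x = 0` is CONSTANT: `x = c·1` (`c` = the `m`-weighted mean). Proof: `y := x − c·1` has
`L y = 0` and `Σ m_i y_i = 0`, so `y*(L − ν₀ M + β m mᵀ)y = −ν₀ Σ m_i|y_i|² ≤ 0`, forcing `y = 0`. [folklore] -/
theorem pencil_ker_eq_const {L : Matrix ι ι ℝ} {m : ι → ℝ} (hm : ∀ i, 0 < m i)
    (hrow : ∀ i, ∑ j, L i j = 0) {ν₀ β : ℝ} (hν₀ : 0 ≤ ν₀)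
    (hS : (L - ν₀ • Matrix.diagonal m + β • Matrix.vecMulVec m m).PosDef)
    {x : ι → ℂ} (hLx : L.map ((↑) : ℝ → ℂ) *ᵥ x = 0) : ∃ c : ℂ, x = fun _ => c := by
  classical
  by_cases hne : Nonempty ι
  swap
  · refine ⟨0, funext fun i => (hne ⟨i⟩).elim⟩
  -- the weighted mean
  have hmsum : 0 < ∑ i, m i := by
    obtain ⟨i⟩ := hne
    exact lt_of_lt_of_le (hm i) (Finset.single_le_sum (f := m) (fun j _ => (hm j).le) (Finset.mem_univ i))
  set c : ℂ := (∑ i, (m i : ℂ) * x i) / ((∑ i, m i : ℝ) : ℂ) with hcdef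
  refine ⟨c, ?_⟩
  set y : ι → ℂ := fun i => x i - c with hydef
  -- (1) `L y = 0` and `Σ m_i y_i = 0`
  have hLy : L.map ((↑) : ℝ → ℂ) *ᵥ y = 0 := by
    have : y = x - fun _ => c := by funext i; simp [hydef]
    rw [this, Matrix.mulVec_sub, hLx, mulVec_const_eq_zero_of_rowsum hrow c, sub_zero]
  have hsum : ∑ i, (m i : ℂ) * y i = 0 := by
    have hS0 : ((∑ i, m i : ℝ) : ℂ) ≠ 0 := by exact_mod_cast hmsum.ne'
    simp only [hydef, mul_sub, Finset.sum_sub_distrib, ← Finset.sum_mul]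
    rw [hcdef]
    have hcast : (∑ i, (m i : ℂ)) = ((∑ i, m i : ℝ) : ℂ) := by push_cast; rfl
    rw [hcast, mul_div_cancel₀ _ hS0, sub_self]
  -- (2) the certificate matrix acts on y as −ν₀·M
  set S : Matrix ι ι ℝ := L - ν₀ • Matrix.diagonal m + β • Matrix.vecMulVec m m with hSdef
  have hSy : ∀ i, (S.map ((↑) : ℝ → ℂ) *ᵥ y) i = -(ν₀ : ℂ) * ((m i : ℂ) * y i) := by
    intro i
    have hLi : ∑ j, (L i j : ℂ) * y j = 0 := by
      have := congr_fun hLy i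
      rw [map_ofReal_mulVec_apply] at this
      simpa using this
    rw [map_ofReal_mulVec_apply]
    have hentry : ∀ j, (S i j : ℂ) * y j
        = (L i j : ℂ) * y j - (if i = j then (ν₀ : ℂ) * ((m i : ℂ) * y j) else 0)
          + (β : ℂ) * (m i : ℂ) * ((m j : ℂ) * y j) := by
      intro j
      simp only [hSdef, Matrix.add_apply, Matrix.sub_apply, Matrix.smul_apply, smul_eq_mul,
        Matrix.vecMulVec_apply]
      by_cases hij : i = j
      · subst hij
        simp only [Matrix.diagonal_apply_eq, if_true]
        push_cast
        ring
      · simp only [Matrix.diagonal_apply_ne _ hij, if_neg hij]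
        push_cast
        ring
    simp_rw [hentry]
    rw [Finset.sum_add_distrib, Finset.sum_sub_distrib, hLi, Finset.sum_ite_eq, ← Finset.mul_sum,
      hsum]
    simp only [Finset.mem_univ, if_true, mul_zero, add_zero]
    ring
  -- (3) `y = 0` by positivity of the certificate
  by_contra hx
  have hy : y ≠ 0 := by
    intro hy0
    apply hx
    funext i
    have := congr_fun hy0 i
    simp only [hydef, Pi.zero_apply, sub_eq_zero] at this
    exact this
  have hSC : (S.map Complex.ofRealHom).PosDef := by
    have hsd : (S.map Complex.ofRealHom).PosSemidef := by
      open scoped MatrixOrder in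
      obtain ⟨B, hB⟩ := CStarAlgebra.nonneg_iff_eq_star_mul_self.mp hS.posSemidef.nonneg
      rw [hB, Matrix.star_eq_conjTranspose, Matrix.map_mul,
        Matrix.conjTranspose_map _ (fun a => by simp)]
      exact Matrix.posSemidef_conjTranspose_mul_self _
    refine hsd.posDef_iff_det_ne_zero.mpr ?_
    rw [← RingHom.mapMatrix_apply, ← RingHom.map_det, Complex.ofRealHom_eq_coe,
      Complex.ofReal_ne_zero]
    exact hS.det_pos.ne'
  have hq : 0 < star y ⬝ᵥ (S.map ((↑) : ℝ → ℂ) *ᵥ y) := hSC.dotProduct_mulVec_pos hy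
  have hqeq : star y ⬝ᵥ (S.map ((↑) : ℝ → ℂ) *ᵥ y)
      = -(ν₀ : ℂ) * ((∑ i, m i * Complex.normSq (y i) : ℝ) : ℂ) := by
    simp only [dotProduct, Pi.star_apply, hSy]
    push_cast
    rw [Finset.mul_sum]
    refine Finset.sum_congr rfl fun i _ => ?_
    rw [Complex.star_def, Complex.normSq_eq_conj_mul_self]
    ring
  have hp : 0 ≤ ∑ i, m i * Complex.normSq (y i) :=
    Finset.sum_nonneg fun i _ => mul_nonneg (hm i).le (Complex.normSq_nonneg _)
  rw [hqeq] at hq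
  obtain ⟨hre, -⟩ := Complex.pos_iff.1 hq
  have : (-(ν₀ : ℂ) * ((∑ i, m i * Complex.normSq (y i) : ℝ) : ℂ)).re
      = -(ν₀ * ∑ i, m i * Complex.normSq (y i)) := by
    rw [← Complex.ofReal_neg, ← Complex.ofReal_mul]
    simp
  rw [this] at hre
  nlinarith [mul_nonneg hν₀ hp]

end Complex

end Summit.Ventures.GridStability.Models

end
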